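import Summits.CriticalPhenomena.PercolationContinuityZ3.Theorems.PercNearOneGluingNoHeavyPcintBFibProcess
import Summits.CriticalPhenomena.PercolationContinuityZ3.Theorems.PercNearOneGluingNoHeavyPcintBFibMarginal
import Summits.CriticalPhenomena.PercolationContinuityZ3.Theorems.PercNearOneGluingNoHeavyPcintUFibAssembly
import HarnessLib

/-!
# PCINT lane, T-fibre route PHASE 3 (bond), step (5c): the fibre-side bridge — block weights versus `P_p` on `𝕋 × F`

Cell `prim-pcint`, seat `prim-pcint-1` (gen 13); memo `run/shared/lean/prim/pcint/T-FIBRE-ROUTE.md` (PHASE 3).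

For the bond configuration `cfgB w` of a block assignment `w` (internal edges of the fibres over `Λ` read through the edge
key `ek`, layer edges of the `𝕋`-edges inside `Λ`), the block product weight `pw π_p` pushes forward to the bond percolation
measure `P_p` of `𝕋 × F` on the events determined by these edges.  Concretely, with `Λ = B_𝕋(x, n)`:

  `Σ_w pw π_p(w) · 𝟙[(x, i₀) is joined in cfgB w to the fibre of a site of ∂ⁱⁿΛ] ≤ P_p((x,i₀) ⟷ ∂B_{𝕋×F}((x,i₀), n))`

(`BFib.sum_pw_joined_le_real_armEvent`).  The edges are parametrised injectively by
`Y = (Λ × canonical keys) ⊕ (EΛ × Φ)` (`edgeY`, `coordY`); the unread block bits integrate out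
(`AdaptDom.sum_wt_comp_of_injective`), and `P_p` of an event determined by these edges is the corresponding finite sum
(`EdgeExpl.real_eq_sum_wt_of_injective`).  Hypotheses on the key: `ek a b = ek b a ∈ {(a,b), (b,a)}` on adjacent pairs.
-/

noncomputable section

namespace Summit.CriticalPhenomena.PercolationContinuityZ3.Theorems.Pcint

namespace BFib

open Finset MeasureTheory AdaptDom EdgeExpl UFib Literature.Probability.Percolation Literature.Probability.LatticeModels

variable {Φ : Type*} [Fintype Φ] [DecidableEq Φ] (FA : SimpleGraph Φ) [DecidableRel FA.Adj] (ek : Φ → Φ → Φ × Φ)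
  {Λ : Finset (Site 2)}

/-! ### Projection of walks of `𝕋 × F` to `𝕋` -/

omit [Fintype Φ] [DecidableEq Φ] [DecidableRel FA.Adj] in
/-- A walk in `𝕋 × F` projects to a walk in `𝕋` that is not longer. -/
theorem exists_walk_fst : ∀ {a b : Site 2 × Φ} (q : (lfib FA).Walk a b), ∃ q' : triGraph.Walk a.1 b.1, q'.length ≤ q.length
  | _, _, SimpleGraph.Walk.nil => ⟨SimpleGraph.Walk.nil, le_rfl⟩
  | a, b, SimpleGraph.Walk.cons h q => by
    obtain ⟨q', hq'⟩ := exists_walk_fst q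
    rcases (lfib_adj FA).1 h with ⟨h1, -⟩ | ⟨h1, -⟩
    · exact ⟨SimpleGraph.Walk.cons h1 q', by simp only [SimpleGraph.Walk.length_cons]; omega⟩
    · exact ⟨q'.copy h1.symm rfl, by simp only [SimpleGraph.Walk.length_copy, SimpleGraph.Walk.length_cons]; omega⟩

omit [DecidableRel FA.Adj] in
/-- A point of the ball of `𝕋 × F` projects into the ball of `𝕋`. -/
theorem fst_mem_ball {x : Site 2} {i : Φ} {m : ℕ} {z : Site 2 × Φ} [DecidableRel FA.Adj]
    (hz : z ∈ DCTQ.ball (lfib FA) (x, i) m) : z.1 ∈ DCTQ.ball triGraph x m := by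
  obtain ⟨q, hq⟩ := DCTQ.mem_ball_iff.1 hz
  obtain ⟨q', hq'⟩ := exists_walk_fst FA q
  exact DCTQ.mem_ball_iff.2 ⟨q', hq'.trans hq⟩

/-- **Exit condition**: a cell above an inner-boundary site of `B_𝕋(x, n)` lies outside the ball `B_{𝕋×F}((x,i), n)` or on its
inner boundary. -/
theorem exit_of_mem_innerBoundary {x : Site 2} {i : Φ} {n : ℕ} {v : Site 2}
    (hv : v ∈ innerBoundary triGraph (DCTQ.ball triGraph x n)) (j : Φ) :
    (v, j) ∉ DCTQ.ball (lfib FA) (x, i) n ∨ (v, j) ∈ innerBoundary (lfib FA) (DCTQ.ball (lfib FA) (x, i) n) := by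
  obtain ⟨-, y, hy, hadj⟩ := mem_innerBoundary_iff.1 hv
  by_cases h : (v, j) ∈ DCTQ.ball (lfib FA) (x, i) n
  · right
    refine mem_innerBoundary_iff.2 ⟨h, (y, j), fun hy' => hy (fst_mem_ball FA hy'), ?_⟩
    exact (lfib_adj FA).2 (Or.inl ⟨hadj, rfl⟩)
  · exact Or.inl h

/-! ### The edge parametrisation -/

/-- The canonical edge keys: adjacent ordered pairs `q` with `ek q.1 q.2 = q`. -/
def keyF : Finset (Φ × Φ) := univ.filter fun q => FA.Adj q.1 q.2 ∧ ek q.1 q.2 = q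

/-- The index of the edges of `𝕋 × F` over `Λ`: internal edges `(v, q)` and layer edges `(e, i)`. -/
abbrev EdgeIdx (Λ : Finset (Site 2)) := (↥Λ × ↥(keyF FA ek)) ⊕ (↥(EΛ triGraph Λ) × Φ)

/-- The edge of `𝕋 × F` indexed by `y`. -/
def edgeY : EdgeIdx FA ek Λ → Sym2 (Site 2 × Φ)
  | Sum.inl (v, q) => s((v.1, q.1.1), (v.1, q.1.2))
  | Sum.inr (e, i) => Sym2.map (fun x => (x, i)) e.1

/-- The block coordinate read for the edge indexed by `y`. -/
def coordY : EdgeIdx FA ek Λ → (↥Λ ⊕ ↥(EΛ triGraph Λ)) × ((Φ × Φ) ⊕ Φ)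
  | Sum.inl (v, q) => (Sum.inl v, Sum.inl q.1)
  | Sum.inr (e, i) => (Sum.inr e, Sum.inr i)

variable {FA ek}
variable (hcomm : ∀ a b, FA.Adj a b → ek a b = ek b a) (hmem : ∀ a b, FA.Adj a b → ek a b = (a, b) ∨ ek a b = (b, a))

/-- Membership in the canonical keys. -/
theorem mem_keyF_iff {q : Φ × Φ} : q ∈ keyF FA ek ↔ FA.Adj q.1 q.2 ∧ ek q.1 q.2 = q := by
  unfold keyF; rw [mem_filter]; simp only [mem_univ, true_and]

include hcomm hmem in
/-- The key of an adjacent pair is canonical. -/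
theorem ek_mem_keyF {a b : Φ} (h : FA.Adj a b) : ek a b ∈ keyF FA ek := by
  rw [mem_keyF_iff]
  rcases hmem a b h with hq | hq
  · rw [hq]; exact ⟨h, hq⟩
  · rw [hq]; exact ⟨h.symm, by rw [← hcomm a b h]; exact hq⟩

/-- `coordY` is injective. -/
theorem coordY_injective : Function.Injective (coordY FA ek (Λ := Λ)) := by
  rintro (⟨v, q⟩ | ⟨e, i⟩) (⟨v', q'⟩ | ⟨e', i'⟩) h <;>
    simp only [coordY, Prod.mk.injEq, Sum.inl.injEq, Sum.inr.injEq, reduceCtorEq, and_false] at h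
  · rw [h.1, Subtype.ext h.2]
  · rw [h.1, h.2]

include hcomm in
/-- `edgeY` is injective. -/
theorem edgeY_injective : Function.Injective (edgeY FA ek (Λ := Λ)) := by
  rintro (⟨v, q⟩ | ⟨e, i⟩) (⟨v', q'⟩ | ⟨e', i'⟩) h
  · simp only [edgeY] at h
    have hq := (mem_keyF_iff.1 q.2)
    have hq' := (mem_keyF_iff.1 q'.2)
    rcases Sym2.eq_iff.1 h with ⟨h1, h2⟩ | ⟨h1, h2⟩
    · obtain ⟨hv, ha⟩ := Prod.mk.inj h1
      obtain ⟨-, hb⟩ := Prod.mk.inj h2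
      rw [Subtype.ext hv, Subtype.ext (Prod.ext ha hb)]
    · obtain ⟨-, ha⟩ := Prod.mk.inj h1
      obtain ⟨-, hb⟩ := Prod.mk.inj h2
      -- `q = (a,b)`, `q' = (b,a)`, both canonical: impossible
      exfalso
      have e1 : ek q.1.1 q.1.2 = q.1 := hq.2
      have e2 : ek q'.1.1 q'.1.2 = q'.1 := hq'.2
      have e3 : ek q.1.1 q.1.2 = ek q.1.2 q.1.1 := hcomm _ _ hq.1
      rw [ha, hb] at e1 e3
      have hqq : q.1 = q'.1 := e1.symm.trans (e3.trans e2)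
      have : q.1.1 = q.1.2 := by rw [ha, hqq]
      exact hq.1.ne this
  · exfalso
    simp only [edgeY] at h
    obtain ⟨e', he'⟩ := e'
    induction e' using Sym2.ind with
    | _ c a =>
      simp only [Sym2.map_mk] at h
      have hca : c ≠ a := ((SimpleGraph.mem_edgeSet triGraph).1 (mem_EΛ_iff.1 he').2).ne
      rcases Sym2.eq_iff.1 h with ⟨h1, h2⟩ | ⟨h1, h2⟩
      · exact hca ((Prod.mk.inj h1).1.symm.trans (Prod.mk.inj h2).1)
      · exact hca ((Prod.mk.inj h2).1.symm.trans (Prod.mk.inj h1).1)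
  · exfalso
    simp only [edgeY] at h
    obtain ⟨e, he⟩ := e
    induction e using Sym2.ind with
    | _ c a =>
      simp only [Sym2.map_mk] at h
      have hca : c ≠ a := ((SimpleGraph.mem_edgeSet triGraph).1 (mem_EΛ_iff.1 he).2).ne
      rcases Sym2.eq_iff.1 h with ⟨h1, h2⟩ | ⟨h1, h2⟩
      · exact hca ((Prod.mk.inj h1).1.trans (Prod.mk.inj h2).1.symm)
      · exact hca ((Prod.mk.inj h1).1.trans (Prod.mk.inj h2).1.symm)
  · simp only [edgeY] at h
    obtain ⟨e, he⟩ := e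
    obtain ⟨e', he'⟩ := e'
    revert h he he'
    induction e using Sym2.ind with
    | _ c a =>
      induction e' using Sym2.ind with
      | _ c' a' =>
        intro he he' h
        simp only [Sym2.map_mk] at h
        rcases Sym2.eq_iff.1 h with ⟨h1, h2⟩ | ⟨h1, h2⟩
        · obtain ⟨hc, hi⟩ := Prod.mk.inj h1
          obtain ⟨ha, -⟩ := Prod.mk.inj h2
          subst hc; subst ha; subst hi; rfl
        · obtain ⟨hc, hi⟩ := Prod.mk.inj h1
          obtain ⟨ha, -⟩ := Prod.mk.inj h2
          subst hc; subst ha; subst hi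
          have : (⟨s(c, a), he⟩ : ↥(EΛ triGraph Λ)) = ⟨s(a, c), he'⟩ := Subtype.ext Sym2.eq_swap
          rw [this]

/-- Every indexed edge is an edge of `𝕋 × F`. -/
theorem edgeY_mem_edgeSet (y : EdgeIdx FA ek Λ) : edgeY FA ek y ∈ (lfib FA).edgeSet := by
  rcases y with ⟨v, q⟩ | ⟨e, i⟩
  · exact (SimpleGraph.mem_edgeSet _).2 ((lfib_adj FA).2 (Or.inr ⟨rfl, (mem_keyF_iff.1 q.2).1⟩))
  · obtain ⟨e, he⟩ := e
    induction e using Sym2.ind with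
    | _ c a =>
      simp only [edgeY, Sym2.map_mk]
      exact (SimpleGraph.mem_edgeSet _).2 ((lfib_adj FA).2
        (Or.inl ⟨(SimpleGraph.mem_edgeSet triGraph).1 (mem_EΛ_iff.1 he).2, rfl⟩))

/-! ### The bond configuration of a block assignment is the parametrised configuration of its read bits -/

include hcomm hmem in
/-- **`cfgB (curry x) = edgeCfg edgeY (x ∘ coordY)`.** -/
theorem cfgB_curry_eq (x : (↥Λ ⊕ ↥(EΛ triGraph Λ)) × ((Φ × Φ) ⊕ Φ) → Bool) :
    cfgB Λ FA ek (Function.curry x) = edgeCfg (edgeY FA ek) (x ∘ coordY FA ek) := by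
  ext E
  simp only [cfgB, edgeCfg, Set.mem_setOf_eq, yOf, hOf, Function.curry_apply, Function.comp_apply]
  constructor
  · rintro (⟨v, a, b, hab, hx, rfl⟩ | ⟨e, c, a, he, i, hx, rfl⟩)
    · refine ⟨Sum.inl (v, ⟨ek a b, ek_mem_keyF hcomm hmem hab⟩), hx, ?_⟩
      simp only [edgeY]
      rcases hmem a b hab with hq | hq
      · simp only [hq]
      · simp only [hq]; exact Sym2.eq_swap
    · refine ⟨Sum.inr (e, i), hx, ?_⟩
      simp only [edgeY, he, Sym2.map_mk]
  · rintro ⟨y, hy, rfl⟩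
    rcases y with ⟨v, q⟩ | ⟨e, i⟩
    · left
      refine ⟨v, q.1.1, q.1.2, (mem_keyF_iff.1 q.2).1, ?_, rfl⟩
      simp only [coordY] at hy
      rw [(mem_keyF_iff.1 q.2).2]; exact hy
    · right
      obtain ⟨c, hce⟩ : ∃ c : ↥Λ, c.1 ∈ (e : Sym2 (Site 2)) := by
        obtain ⟨e, he⟩ := e
        induction e using Sym2.ind with
        | _ c a => exact ⟨⟨c, (mem_EΛ_iff.1 he).1 c (Sym2.mem_iff.2 (Or.inl rfl))⟩, Sym2.mem_iff.2 (Or.inl rfl)⟩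
      obtain ⟨a, hea, -⟩ := exists_other (e := e) hce
      refine ⟨e, c, a, hea, i, ?_, ?_⟩
      · simp only [coordY] at hy; exact hy
      · simp only [edgeY, hea, Sym2.map_mk]

/-! ### The bridge -/

variable (o : ↥Λ) (i₀ : Φ) (p : unitInterval)

/-- The event, determined by the parametrised edges, that the root cell is joined inside their configuration to the fibre
of a site of `B`. -/
def joinEvent (B : Finset ↥Λ) : Set (BondConfig (Site 2 × Φ)) :=
  {ω | ∃ v ∈ B, ∃ j : Φ, PathIn (openGraph (ω ∩ Set.range (edgeY FA ek (Λ := Λ)))) Set.univ (o.1, i₀) (v.1, j)}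

variable {o i₀ p}

omit [DecidableRel FA.Adj] in
/-- `joinEvent` is determined by the parametrised edges. -/
theorem determinedBy_joinEvent [DecidableRel FA.Adj] (B : Finset ↥Λ) :
    DeterminedBy (joinEvent (FA := FA) (ek := ek) o i₀ B) (Set.range (edgeY FA ek (Λ := Λ))) := by
  rw [determinedBy_iff]
  intro ω ω' h
  unfold joinEvent
  simp only [Set.mem_setOf_eq, h]

omit [Fintype Φ] [DecidableEq Φ] [DecidableRel FA.Adj] in
/-- Open paths are monotone in the configuration. -/
theorem pathIn_openGraph_mono {ω ω' : BondConfig (Site 2 × Φ)} (h : ω ⊆ ω') {a b : Site 2 × Φ}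
    (hp : PathIn (openGraph ω) Set.univ a b) : PathIn (openGraph ω') Set.univ a b :=
  hp.mono_graph fun _ _ hxy => (openGraph_adj _ _ _).2 ⟨h ((openGraph_adj _ _ _).1 hxy).1, ((openGraph_adj _ _ _).1 hxy).2⟩

variable (FA ek) in
open Classical in
/-- The payoff of the bond route on the fibre side: `𝟙[(o, i₀) is joined in cfgB w to the fibre of a site of B]`. -/
def joinedInd (o : ↥Λ) (i₀ : Φ) (B : Finset ↥Λ) (w : (↥Λ ⊕ ↥(EΛ triGraph Λ)) → Blk Φ) : ℝ :=
  if ∃ v ∈ B, ∃ j : Φ, Joined o FA ek i₀ w (v.1, j) then 1 else 0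

omit [DecidableEq Φ] [DecidableRel FA.Adj] in
/-- `0 ≤ joinedInd ≤ 1`. -/
theorem joinedInd_mem (o : ↥Λ) (i₀ : Φ) (B : Finset ↥Λ) (w : (↥Λ ⊕ ↥(EΛ triGraph Λ)) → Blk Φ) :
    0 ≤ joinedInd FA ek o i₀ B w ∧ joinedInd FA ek o i₀ B w ≤ 1 := by
  unfold joinedInd; split_ifs <;> norm_num

omit [DecidableEq Φ] [DecidableRel FA.Adj] in
/-- `joinedInd = 1` when the root cell is joined to the fibre of a site of `B`. -/
theorem joinedInd_eq_one {o : ↥Λ} {i₀ : Φ} {B : Finset ↥Λ} {w : (↥Λ ⊕ ↥(EΛ triGraph Λ)) → Blk Φ}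
    (h : ∃ v ∈ B, ∃ j : Φ, Joined o FA ek i₀ w (v.1, j)) : joinedInd FA ek o i₀ B w = 1 := by
  unfold joinedInd; rw [if_pos h]

include hcomm hmem in
/-- **The fibre-side bridge**: for `Λ = B_𝕋(x, n)` and `B` = the sites of `Λ` on its inner boundary,
`Σ_w pw π_p(w) 𝟙[(x,i₀) joined in cfgB w to the fibre of a site of B] ≤ P_p((x,i₀) ⟷ ∂B_{𝕋×F}((x,i₀), n))`. -/
theorem sum_pw_joinedInd_le_real_armEvent {x : Site 2} {n : ℕ} (hx : x ∈ DCTQ.ball triGraph x n) (i₀ : Φ)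
    (p : unitInterval) :
    ∑ w : (↥(DCTQ.ball triGraph x n) ⊕ ↥(EΛ triGraph (DCTQ.ball triGraph x n))) → Blk Φ, pw (fun _ => wt (p : ℝ)) w *
        joinedInd FA ek ⟨x, hx⟩ i₀
          ((DCTQ.ball triGraph x n).attach.filter (fun v => v.1 ∈ innerBoundary triGraph (DCTQ.ball triGraph x n))) w ≤
      (bondPercolation (lfib FA) p).real (DCTQ.armEvent (lfib FA) (x, i₀) n) := by
  classical
  set Λ := DCTQ.ball triGraph x n with hΛ
  set B := Λ.attach.filter (fun v => v.1 ∈ innerBoundary triGraph Λ) with hB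
  set 𝓔 := joinEvent (FA := FA) (ek := ek) ⟨x, hx⟩ i₀ B with h𝓔
  -- the payoff as a function of the read bits
  have hind : ∀ w : (↥Λ ⊕ ↥(EΛ triGraph Λ)) → Blk Φ,
      joinedInd FA ek ⟨x, hx⟩ i₀ B w = 𝓔.indicator 1 (edgeCfg (edgeY FA ek) ((Function.uncurry w) ∘ coordY FA ek)) := by
    intro w
    have hcfg : cfgB Λ FA ek w = edgeCfg (edgeY FA ek) ((Function.uncurry w) ∘ coordY FA ek) := by
      have := cfgB_curry_eq hcomm hmem (Λ := Λ) (Function.uncurry w)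
      simpa using this
    have hrange : edgeCfg (edgeY FA ek) ((Function.uncurry w) ∘ coordY FA ek) ∩ Set.range (edgeY FA ek (Λ := Λ)) =
        edgeCfg (edgeY FA ek) ((Function.uncurry w) ∘ coordY FA ek) := by
      refine Set.inter_eq_left.2 ?_
      rintro E ⟨y, -, rfl⟩; exact ⟨y, rfl⟩
    have hiff : (∃ v ∈ B, ∃ j : Φ, Joined ⟨x, hx⟩ FA ek i₀ w (v.1, j)) ↔
        edgeCfg (edgeY FA ek) ((Function.uncurry w) ∘ coordY FA ek) ∈ 𝓔 := by
      rw [h𝓔]; unfold joinEvent Joined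
      rw [Set.mem_setOf_eq, hrange, ← hcfg]
    unfold joinedInd
    split_ifs with h
    · rw [Set.indicator_of_mem (hiff.1 h)]; rfl
    · rw [Set.indicator_of_notMem (fun h' => h (hiff.2 h'))]
  simp_rw [hind]
  rw [sum_pw_eq_sum_wt_curry (p : ℝ) (fun w : (↥Λ ⊕ ↥(EΛ triGraph Λ)) → Blk Φ =>
    𝓔.indicator 1 (edgeCfg (edgeY FA ek) ((Function.uncurry w) ∘ coordY FA ek)))]
  simp only [Function.uncurry_curry]
  rw [sum_wt_comp_of_injective (p : ℝ) (coordY_injective (FA := FA) (ek := ek) (Λ := Λ))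
    (fun a => 𝓔.indicator 1 (edgeCfg (edgeY FA ek) a)),
    ← real_eq_sum_wt_of_injective (lfib FA) p (edgeY FA ek) (edgeY_injective hcomm) edgeY_mem_edgeSet
      (determinedBy_joinEvent B)]
  -- `𝓔 ⊆ armEvent` almost surely
  refine DCT16.real_mono_of_forall_subset_edgeSet (lfib FA) p fun ω hω hE => ?_
  obtain ⟨v, hv, j, hpath⟩ := hE
  have hvb : v.1 ∈ innerBoundary triGraph Λ := (mem_filter.1 hv).2
  exact DCTQ.armEvent_of_pathIn hω (pathIn_openGraph_mono Set.inter_subset_left hpath)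
    (exit_of_mem_innerBoundary FA hvb j)

end BFib

end Summit.CriticalPhenomena.PercolationContinuityZ3.Theorems.Pcint

end
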